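import Summits.Ventures.YMGap.RobustBall.MassGapOnBallZdG
import Summits.Ventures.YMGap.RobustBall.LoopActionMember
import HarnessLib

/-!
# Venture YMGap, track ROBUST-BALL (Y2) — the UNIFORM `ℤ^d` mass-gap currencies (definitions and bridges)

HONEST FRAMING. WHAT THIS IS: a venture file (cell `pub-ymgap`, track Y2 ROBUST-BALL, seat rb-p1,
DEFINITIONS + one-line bridges, no door, no number). The landed `ℤ^d` currencies of the track —
`MassGapOnBallZd` (tier 1), `MassGapOnBallZdS` (tier 2, weighted), `MassGapOnBallZdG` (gauge-invariant
tier 1, ds-2) and `MassGapOnLoopBall` (generic Wilson-type loop actions) — conclude, for every member of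
the ball, the cell's `PerturbedMassGapAt[S]`: exactly one DLR state and, FOR EVERY DLR STATE, SOME rate
`c > 0` and SOME constants `c₁(n)` of Shen–Zhu–Zhu clustering. In that shape the rate and the constants
are allowed to depend on the member: the statement is POINTWISE on the ball. The directive's word
«uniformly on `ClusterDomain β⋆ ε`» asks for more, and the doors deliver more (every landed door carries
explicit constants depending on `(N, d, β, loads, range)` only). This file TYPES the uniform currencies:
* `PerturbedClustering d N β W supp m A` — EVERY DLR state `μ` of the member `N β S_W + W` satisfies, for
  every support bound `n` and all Lipschitz cylinder observables `F₁, F₂` with disjoint supports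
  `|Λᵢ| ≤ n`, `|cov_μ(F₁, F₂)| ≤ A n² e^{-m d(Λ₁, Λ₂)} (K₁ K₂ + ‖F₁‖₂ ‖F₂‖₂)` — ONE rate `m`, ONE constant
  `A`; `PerturbedClusteringS` the same for the summable (tier-2) specification;
* `UniformMassGapOnBallZd d N β ε₀ ε₁ R m A := 0 < m ∧ ∀ members of MemBallZd ε₀ ε₁ R, unique DLR state ∧
  PerturbedClustering … m A` — and the twins `UniformMassGapOnBallZdS d N β a Λ t m A`,
  `UniformMassGapOnBallZdG d N β ε₀ ε₁ R m A`, `UniformMassGapOnLoopBall d N β w ε m A`;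
* bridges: each uniform currency implies the landed pointwise one (`UniformMassGapOnBallZd.massGapOnBallZd`,
  `…ZdS.massGapOnBallZdS`, `…ZdG.massGapOnBallZdG`, `…LoopBall.massGapOnLoopBall`) and the Wilson theorem
  (`….massGapAt`); monotonicity in the radii, the rate (down) and the constant (up); inclusions
  tier 1 → gauge ball (`UniformMassGapOnBallZd.uniformMassGapOnBallZdG`), tier 2 → tier 1
  (`UniformMassGapOnBallZdS.uniformMassGapOnBallZd`, cost `e^{tR}` on the cross load) and tier 2 → loop
  ball (`UniformMassGapOnBallZdS.uniformMassGapOnLoopBall`, via rb-p1's `memBallZdS_loopFamilyAction`).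
WHAT THIS IS NOT: nothing is asserted by a definition; the doors with their explicit `(m, A)` are separate
files; «uniform» = ONE `(m, A)` for every member of the ball and every DLR state (constants depending on
`(N, d, β, radii, range/weight)` only) — a strong-coupling LATTICE statement, nothing about the continuum
limit or a Clay-sense mass gap; `1/m` bounds the correlation length of the member from ABOVE only.

## References
* Shen–Zhu–Zhu, CMP 400 (2023), Cor. 1.6 (the clustering shape); Föllmer 1988 Ch. I Thm. (2.13);
  Georgii 2011, Thm. 8.20 / (8.28) (explicit constants of the Dobrushin regime).
* The tree: `RobustBall/MassGapOnBall.lean` (`PerturbedMassGapAt`, `MemBallZd`, `MassGapOnBallZd`),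
  `MassGapOnBallS.lean`, `MassGapOnBallZdG.lean` (ds-2), `LoopActionMember.lean` (`MassGapOnLoopBall`).
-/

noncomputable section

open MeasureTheory Filter Function ProbabilityTheory Real
open scoped NNReal
open Literature.Probability.LatticeModels
open Literature.Probability.LatticeModels.DobrushinMetric
open Literature.MathematicalPhysics.QuantumLattice
open Literature.MathematicalPhysics.QuantumFieldTheory hiding ZdEdge Site

namespace Summit.Ventures.YMGap.RobustBall

variable {d N : ℕ}

/-! ### Uniform clustering data of one member -/

section Member

variable (d N) in
/-- **Exponential clustering of the member `N β S_W + W` with rate `m` and constant `A`**: EVERY DLR state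
`μ` of `perturbedYM (fundamentalRep (Fin N)) (N β) W supp` satisfies, for every support bound `n`, every pair
of Lipschitz cylinder observables `F₁, F₂` (Shen–Zhu–Zhu class) with disjoint supports `|Λ₁|, |Λ₂| ≤ n`,
`|cov_μ(F₁, F₂)| ≤ A · n² · e^{-m d(Λ₁, Λ₂)} (K₁ K₂ + ‖F₁‖_{L²(μ)} ‖F₂‖_{L²(μ)})` — the body of the cell's
`MassGapAt` (ii) with the quantifiers `∃ c, ∃ c₁` replaced by the GIVEN `(m, A n²)`. [folklore] -/
def PerturbedClustering (β : ℝ) (W : Potential (ZdEdge d) (Matrix.specialUnitaryGroup (Fin N) ℂ))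
    (supp : Finset (ZdEdge d) → Finset (Finset (ZdEdge d))) (m A : ℝ) : Prop :=
  ∀ μ ∈ perturbedGibbsMeasures (d := d) (fundamentalRep (Fin N)) (N * β) W supp,
    ∀ (n : ℕ) (F₁ F₂ : LGConfig d (Matrix.specialUnitaryGroup (Fin N) ℂ) → ℝ)
      (Λ₁ Λ₂ : Finset (ZdEdge d)) (K₁ K₂ : ℝ≥0),
      Λ₁.card ≤ n → Λ₂.card ≤ n → Disjoint Λ₁ Λ₂ →
      IsLipschitzCylinder (fundamentalRep (Fin N)) F₁ Λ₁ K₁ →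
      IsLipschitzCylinder (fundamentalRep (Fin N)) F₂ Λ₂ K₂ →
        |cov[F₁, F₂; μ]| ≤ A * (n : ℝ) ^ 2 * Real.exp (-m * setDistEdges Λ₁ Λ₂) *
          ((K₁ : ℝ) * K₂ + Real.sqrt (∫ U, F₁ U ^ 2 ∂μ) * Real.sqrt (∫ U, F₂ U ^ 2 ∂μ))

variable (d N) in
/-- **Exponential clustering of the summable (tier-2) member** with rate `m` and constant `A`: the same body
for the DLR states of `perturbedYMS (fundamentalRep (Fin N)) (N β) W`. [folklore] -/
def PerturbedClusteringS (β : ℝ) (W : Potential (ZdEdge d) (Matrix.specialUnitaryGroup (Fin N) ℂ))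
    (m A : ℝ) : Prop :=
  ∀ μ ∈ perturbedGibbsMeasuresS (d := d) (fundamentalRep (Fin N)) (N * β) W,
    ∀ (n : ℕ) (F₁ F₂ : LGConfig d (Matrix.specialUnitaryGroup (Fin N) ℂ) → ℝ)
      (Λ₁ Λ₂ : Finset (ZdEdge d)) (K₁ K₂ : ℝ≥0),
      Λ₁.card ≤ n → Λ₂.card ≤ n → Disjoint Λ₁ Λ₂ →
      IsLipschitzCylinder (fundamentalRep (Fin N)) F₁ Λ₁ K₁ →
      IsLipschitzCylinder (fundamentalRep (Fin N)) F₂ Λ₂ K₂ →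
        |cov[F₁, F₂; μ]| ≤ A * (n : ℝ) ^ 2 * Real.exp (-m * setDistEdges Λ₁ Λ₂) *
          ((K₁ : ℝ) * K₂ + Real.sqrt (∫ U, F₁ U ^ 2 ∂μ) * Real.sqrt (∫ U, F₂ U ^ 2 ∂μ))

variable {β m m' A A' : ℝ} {W : Potential (ZdEdge d) (Matrix.specialUnitaryGroup (Fin N) ℂ)}
  {supp : Finset (ZdEdge d) → Finset (Finset (ZdEdge d))}

/-- For a potential supported by finite families the tier-2 clustering data ARE the tier-1 data
(`perturbedYMS_eq_perturbedYM`). [folklore] -/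
theorem perturbedClusteringS_iff_of_supportedBy (hsupp : W.IsSupportedBy supp) :
    PerturbedClusteringS d N β W m A ↔ PerturbedClustering d N β W supp m A := by
  unfold PerturbedClusteringS PerturbedClustering perturbedGibbsMeasuresS perturbedGibbsMeasures
  rw [perturbedYMS_eq_perturbedYM _ _ hsupp]

/-- **Uniform data give the cell's pointwise currency**: uniqueness + clustering with a rate `m > 0` and a
constant `A` is `PerturbedMassGapAt d N β W supp` (take `c = m`, `c₁ = A n²`). [folklore] -/
theorem PerturbedClustering.perturbedMassGapAt
    (hu : HasUniqueGibbsMeasure (perturbedYM (d := d) (fundamentalRep (Fin N)) (N * β) W supp))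
    (hm : 0 < m) (h : PerturbedClustering d N β W supp m A) : PerturbedMassGapAt d N β W supp :=
  ⟨hu, fun μ hμ => ⟨m, hm, fun n => ⟨A * (n : ℝ) ^ 2, fun F₁ F₂ Λ₁ Λ₂ K₁ K₂ h₁ h₂ hdj hF₁ hF₂ =>
    h μ hμ n F₁ F₂ Λ₁ Λ₂ K₁ K₂ h₁ h₂ hdj hF₁ hF₂⟩⟩⟩

/-- The tier-2 twin: uniqueness + `PerturbedClusteringS` with `m > 0` is `PerturbedMassGapAtS`. [folklore] -/
theorem PerturbedClusteringS.perturbedMassGapAtS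
    (hu : HasUniqueGibbsMeasure (perturbedYMS (d := d) (fundamentalRep (Fin N)) (N * β) W))
    (hm : 0 < m) (h : PerturbedClusteringS d N β W m A) : PerturbedMassGapAtS d N β W :=
  ⟨hu, fun μ hμ => ⟨m, hm, fun n => ⟨A * (n : ℝ) ^ 2, fun F₁ F₂ Λ₁ Λ₂ K₁ K₂ h₁ h₂ hdj hF₁ hF₂ =>
    h μ hμ n F₁ F₂ Λ₁ Λ₂ K₁ K₂ h₁ h₂ hdj hF₁ hF₂⟩⟩⟩

/-- The clustering bound is monotone: a smaller rate and a larger (nonnegative) constant still hold. -/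
theorem clusteringBound_mono {n : ℕ} {D X : ℝ} (hX : 0 ≤ X) (hm : m' ≤ m) (hA : A ≤ A') (hA' : 0 ≤ A')
    (hD : 0 ≤ D) :
    A * (n : ℝ) ^ 2 * Real.exp (-m * D) * X ≤ A' * (n : ℝ) ^ 2 * Real.exp (-m' * D) * X := by
  have h1 : A * (n : ℝ) ^ 2 * Real.exp (-m * D) * X ≤ A' * (n : ℝ) ^ 2 * Real.exp (-m * D) * X := by
    have : 0 ≤ (n : ℝ) ^ 2 * Real.exp (-m * D) * X := by positivity
    nlinarith
  have h2 : Real.exp (-m * D) ≤ Real.exp (-m' * D) := Real.exp_le_exp.2 (by nlinarith)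
  calc A * (n : ℝ) ^ 2 * Real.exp (-m * D) * X ≤ A' * (n : ℝ) ^ 2 * Real.exp (-m * D) * X := h1
    _ ≤ A' * (n : ℝ) ^ 2 * Real.exp (-m' * D) * X := by
        have : 0 ≤ A' * (n : ℝ) ^ 2 := by positivity
        have hmul := mul_le_mul_of_nonneg_left h2 this
        exact mul_le_mul_of_nonneg_right hmul hX

/-- **Monotonicity of the clustering data**: rate down (`m' ≤ m`), constant up (`A ≤ A'`, `0 ≤ A'`). [folklore] -/
theorem PerturbedClustering.mono (h : PerturbedClustering d N β W supp m A) (hm : m' ≤ m) (hA : A ≤ A')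
    (hA' : 0 ≤ A') : PerturbedClustering d N β W supp m' A' :=
  fun μ hμ n F₁ F₂ Λ₁ Λ₂ K₁ K₂ h₁ h₂ hdj hF₁ hF₂ =>
    (h μ hμ n F₁ F₂ Λ₁ Λ₂ K₁ K₂ h₁ h₂ hdj hF₁ hF₂).trans
      (clusteringBound_mono (by positivity) hm hA hA' (setDistEdges_nonneg _ _))

/-- Monotonicity of the tier-2 clustering data. [folklore] -/
theorem PerturbedClusteringS.mono (h : PerturbedClusteringS d N β W m A) (hm : m' ≤ m) (hA : A ≤ A')
    (hA' : 0 ≤ A') : PerturbedClusteringS d N β W m' A' :=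
  fun μ hμ n F₁ F₂ Λ₁ Λ₂ K₁ K₂ h₁ h₂ hdj hF₁ hF₂ =>
    (h μ hμ n F₁ F₂ Λ₁ Λ₂ K₁ K₂ h₁ h₂ hdj hF₁ hF₂).trans
      (clusteringBound_mono (by positivity) hm hA hA' (setDistEdges_nonneg _ _))

end Member

/-! ### The uniform currencies on the four balls -/

section Balls

variable (d N) in
/-- **MASS GAP UNIFORMLY ON THE TIER-1 `ℤ^d` BALL, with rate `m` and constant `A`**: `0 < m`, and EVERY
member `(W, supp)` of `MemBallZd ε₀ ε₁ R` at 't Hooft coupling `β` has exactly one DLR state and clusters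
with THE SAME `(m, A)` (`PerturbedClustering d N β W supp m A`). ONE inverse correlation-length bound `m`
for the whole ball. Nothing is asserted by the definition. [folklore] -/
def UniformMassGapOnBallZd (β ε₀ ε₁ R m A : ℝ) : Prop :=
  0 < m ∧ ∀ (W : Potential (ZdEdge d) (Matrix.specialUnitaryGroup (Fin N) ℂ))
    (supp : Finset (ZdEdge d) → Finset (Finset (ZdEdge d))), MemBallZd ε₀ ε₁ R W supp →
      HasUniqueGibbsMeasure (perturbedYM (d := d) (fundamentalRep (Fin N)) (N * β) W supp) ∧
        PerturbedClustering d N β W supp m A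

variable (d N) in
/-- **MASS GAP UNIFORMLY ON THE TIER-2 (WEIGHTED) `ℤ^d` BALL, with rate `m` and constant `A`**: `0 < m`,
and EVERY member of `MemBallZdS a Λ t` has exactly one DLR state and `PerturbedClusteringS d N β W m A`.
[folklore] -/
def UniformMassGapOnBallZdS (β a Λ t m A : ℝ) : Prop :=
  0 < m ∧ ∀ W : Potential (ZdEdge d) (Matrix.specialUnitaryGroup (Fin N) ℂ), MemBallZdS a Λ t W →
    HasUniqueGibbsMeasure (perturbedYMS (d := d) (fundamentalRep (Fin N)) (N * β) W) ∧
      PerturbedClusteringS d N β W m A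

variable (d N) in
/-- **MASS GAP UNIFORMLY ON THE GAUGE-INVARIANT TIER-1 `ℤ^d` BALL (ds-2's `MemBallZdG ε₀ ε₁ R`), with rate
`m` and constant `A`.** [folklore] -/
def UniformMassGapOnBallZdG (β ε₀ ε₁ : ℝ) (R : ℕ) (m A : ℝ) : Prop :=
  0 < m ∧ ∀ (W : Potential (ZdEdge d) (SUN N)) (supp : Finset (ZdEdge d) → Finset (Finset (ZdEdge d))),
    MemBallZdG ε₀ ε₁ R W supp →
      HasUniqueGibbsMeasure (perturbedYM (d := d) (fundamentalRep (Fin N)) (N * β) W supp) ∧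
        PerturbedClustering d N β W supp m A

variable (d N) in
/-- **MASS GAP UNIFORMLY ON THE LOOP-ACTION NORM BALL `‖c‖_w ≤ ε`, with rate `m` and constant `A`**: `0 < m`,
and EVERY generic Wilson-type loop action `loopFamilyAction N γ c` (any index type, finite carrier fibres)
with `LoopNormLE w γ c ε` has exactly one DLR state and `PerturbedClusteringS d N β (loopFamilyAction N γ c) m A`.
[folklore] -/
def UniformMassGapOnLoopBall (β w ε m A : ℝ) : Prop :=
  0 < m ∧ ∀ (ι : Type) (γ : ι → ZdLoop d) (c : ι → ℝ), (∀ X, {i | walkEdges (γ i).walk = X}.Finite) →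
    LoopNormLE w γ c ε →
      HasUniqueGibbsMeasure
          (perturbedYMS (d := d) (fundamentalRep (Fin N)) (N * β) (loopFamilyAction (d := d) N γ c)) ∧
        PerturbedClusteringS d N β (loopFamilyAction (d := d) N γ c) m A

variable {β ε₀ ε₁ R a Λ t w ε m m' A A' : ℝ}

/-! #### Uniform ⇒ pointwise (the landed currencies) ⇒ the Wilson theorem -/

/-- **The uniform tier-1 theorem contains the landed pointwise one** `MassGapOnBallZd d N β ε₀ ε₁ R`. [folklore] -/
theorem UniformMassGapOnBallZd.massGapOnBallZd (h : UniformMassGapOnBallZd d N β ε₀ ε₁ R m A) :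
    MassGapOnBallZd d N β ε₀ ε₁ R :=
  fun W supp hW => (h.2 W supp hW).2.perturbedMassGapAt (h.2 W supp hW).1 h.1

/-- The uniform tier-2 theorem contains `MassGapOnBallZdS d N β a Λ t`. [folklore] -/
theorem UniformMassGapOnBallZdS.massGapOnBallZdS (h : UniformMassGapOnBallZdS d N β a Λ t m A) :
    MassGapOnBallZdS d N β a Λ t :=
  fun W hW => (h.2 W hW).2.perturbedMassGapAtS (h.2 W hW).1 h.1

/-- The uniform gauge-ball theorem contains ds-2's `MassGapOnBallZdG d N β ε₀ ε₁ R`. [folklore] -/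
theorem UniformMassGapOnBallZdG.massGapOnBallZdG {R : ℕ} (h : UniformMassGapOnBallZdG d N β ε₀ ε₁ R m A) :
    MassGapOnBallZdG d N β ε₀ ε₁ R :=
  fun W supp hW => (h.2 W supp hW).2.perturbedMassGapAt (h.2 W supp hW).1 h.1

/-- The uniform loop-ball theorem contains `MassGapOnLoopBall d N β w ε`. [folklore] -/
theorem UniformMassGapOnLoopBall.massGapOnLoopBall (h : UniformMassGapOnLoopBall d N β w ε m A) :
    MassGapOnLoopBall d N β w ε :=
  fun ι γ c hfin hn => (h.2 ι γ c hfin hn).2.perturbedMassGapAtS (h.2 ι γ c hfin hn).1 h.1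

/-- The uniform tier-1 theorem contains the Wilson theorem `MassGapAt d N β` (`0 ≤ ε₀, ε₁, R`). [folklore] -/
theorem UniformMassGapOnBallZd.massGapAt (h : UniformMassGapOnBallZd d N β ε₀ ε₁ R m A) (h₀ : 0 ≤ ε₀)
    (h₁ : 0 ≤ ε₁) : MassGapAt d N β :=
  h.massGapOnBallZd.massGapAt h₀ h₁

/-- The uniform gauge-ball theorem contains the Wilson theorem. [folklore] -/
theorem UniformMassGapOnBallZdG.massGapAt {R : ℕ} (h : UniformMassGapOnBallZdG d N β ε₀ ε₁ R m A)
    (h₀ : 0 ≤ ε₀) (h₁ : 0 ≤ ε₁) : MassGapAt d N β :=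
  h.massGapOnBallZdG.massGapAt h₀ h₁

/-- **The Wilson point with its explicit rate**: the uniform tier-1 theorem gives, for EVERY DLR state of
the unperturbed `SU(N)` theory at 't Hooft coupling `β`, clustering with the ball's `(m, A)`
(the zero member with the empty support family; `perturbedGibbsMeasures_zero`). [folklore] -/
theorem UniformMassGapOnBallZd.clustering_wilson (h : UniformMassGapOnBallZd d N β ε₀ ε₁ R m A)
    (h₀ : 0 ≤ ε₀) (h₁ : 0 ≤ ε₁) :
    PerturbedClustering d N β 0 (fun _ => (∅ : Finset (Finset (ZdEdge d)))) m A :=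
  (h.2 0 _ (memBallZd_zero h₀ h₁ fun _ _ h => by simp at h)).2

/-! #### Monotonicity -/

/-- **Monotonicity of the uniform tier-1 currency**: smaller radii and range, smaller rate (`0 < m' ≤ m`),
larger constant (`A ≤ A'`, `0 ≤ A'`). [folklore] -/
theorem UniformMassGapOnBallZd.mono {ε₀' ε₁' R' : ℝ} (h : UniformMassGapOnBallZd d N β ε₀ ε₁ R m A)
    (h₀ : ε₀' ≤ ε₀) (h₁ : ε₁' ≤ ε₁) (hR : R' ≤ R) (hm' : 0 < m') (hm : m' ≤ m) (hA : A ≤ A')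
    (hA' : 0 ≤ A') : UniformMassGapOnBallZd d N β ε₀' ε₁' R' m' A' := by
  refine ⟨hm', fun W supp hW => ?_⟩
  obtain ⟨osc, lip, hosc, hlip, hl₀, hl₁⟩ := hW.loads
  have hW' : MemBallZd ε₀ ε₁ R W supp :=
    ⟨hW.continuous, hW.dependsOn, hW.supportedBy,
      fun e X hX heX y hy => (hW.range e X hX heX y hy).trans hR, osc, lip, hosc, hlip,
      fun e => (hl₀ e).trans h₀, fun e => (hl₁ e).trans h₁⟩
  exact ⟨(h.2 W supp hW').1, (h.2 W supp hW').2.mono hm hA hA'⟩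

/-- Monotonicity of the uniform tier-2 currency (loads down, rate down, constant up; same weight). [folklore] -/
theorem UniformMassGapOnBallZdS.mono {a' Λ' : ℝ} (h : UniformMassGapOnBallZdS d N β a Λ t m A)
    (ha : a' ≤ a) (hΛ : Λ' ≤ Λ) (hm' : 0 < m') (hm : m' ≤ m) (hA : A ≤ A') (hA' : 0 ≤ A') :
    UniformMassGapOnBallZdS d N β a' Λ' t m' A' :=
  ⟨hm', fun W hW => ⟨(h.2 W (hW.mono ha hΛ)).1, (h.2 W (hW.mono ha hΛ)).2.mono hm hA hA'⟩⟩

/-- Monotonicity of the uniform gauge-ball currency. [folklore] -/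
theorem UniformMassGapOnBallZdG.mono {ε₀' ε₁' : ℝ} {R R' : ℕ} (h : UniformMassGapOnBallZdG d N β ε₀ ε₁ R m A)
    (h₀ : ε₀' ≤ ε₀) (h₁ : ε₁' ≤ ε₁) (hR : R' ≤ R) (hm' : 0 < m') (hm : m' ≤ m) (hA : A ≤ A')
    (hA' : 0 ≤ A') : UniformMassGapOnBallZdG d N β ε₀' ε₁' R' m' A' := by
  refine ⟨hm', fun W supp hW => ?_⟩
  obtain ⟨osc, lip, hosc, hlip, hl₀, hl₁⟩ := hW.loads
  have hW' : MemBallZdG ε₀ ε₁ R W supp :=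
    ⟨hW.continuous, hW.dependsOn, hW.supportedBy,
      fun e X hX heX y hy => (hW.range e X hX heX y hy).trans (by exact_mod_cast hR), hW.gaugeInvariant,
      osc, lip, hosc, hlip, fun e => (hl₀ e).trans h₀, fun v => (hl₁ v).trans h₁⟩
  exact ⟨(h.2 W supp hW').1, (h.2 W supp hW').2.mono hm hA hA'⟩

/-- Monotonicity of the uniform loop-ball currency (radius down, rate down, constant up; same weight). [folklore] -/
theorem UniformMassGapOnLoopBall.mono {ε' : ℝ} (h : UniformMassGapOnLoopBall d N β w ε m A) (hε : ε' ≤ ε)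
    (hm' : 0 < m') (hm : m' ≤ m) (hA : A ≤ A') (hA' : 0 ≤ A') : UniformMassGapOnLoopBall d N β w ε' m' A' :=
  ⟨hm', fun ι γ c hfin hn =>
    ⟨(h.2 ι γ c hfin (hn.mono hε)).1, (h.2 ι γ c hfin (hn.mono hε)).2.mono hm hA hA'⟩⟩

/-! #### Inclusions between the balls -/

/-- **Tier 1 ⇒ gauge ball**: ds-2's `MemBallZdG ε₀ ε₁ R` is a sub-ball of `MemBallZd ε₀ ε₁ R`
(`MemBallZdG.memBallZd`), so every uniform tier-1 row is a uniform gauge-ball row with the same `(m, A)`. [folklore] -/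
theorem UniformMassGapOnBallZd.uniformMassGapOnBallZdG {R : ℕ} (h : UniformMassGapOnBallZd d N β ε₀ ε₁ R m A) :
    UniformMassGapOnBallZdG d N β ε₀ ε₁ R m A :=
  ⟨h.1, fun W supp hW => h.2 W supp hW.memBallZd⟩

/-- **Tier 2 ⇒ tier 1**: the weighted ball of loads `(a, Λ)` at weight `t ≥ 0` contains every tier-1 ball
`MemBallZd ε₀ ε₁ R` with `ε₀ ≤ a`, `e^{tR} ε₁ ≤ Λ` (`MemBallZd.memBallZdS`), and on finitely supported members
the two specifications agree — so the uniform tier-2 row is a uniform tier-1 row with the same `(m, A)`. [folklore] -/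
theorem UniformMassGapOnBallZdS.uniformMassGapOnBallZd (h : UniformMassGapOnBallZdS d N β a Λ t m A)
    (ht : 0 ≤ t) (h₀ : ε₀ ≤ a) (h₁ : exp (t * R) * ε₁ ≤ Λ) : UniformMassGapOnBallZd d N β ε₀ ε₁ R m A := by
  refine ⟨h.1, fun W supp hW => ?_⟩
  obtain ⟨hu, hc⟩ := h.2 W ((hW.memBallZdS ht).mono h₀ h₁)
  refine ⟨?_, (perturbedClusteringS_iff_of_supportedBy hW.supportedBy).1 hc⟩
  unfold HasUniqueGibbsMeasure at hu ⊢
  rwa [perturbedYMS_eq_perturbedYM _ _ hW.supportedBy] at hu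

/-- **Tier 2 ⇒ loop ball**: a loop action with finite carrier fibres and `‖c‖_w ≤ ε` lies in
`MemBallZdS (2ε) ε w` (rb-p1's `memBallZdS_loopFamilyAction`), so `UniformMassGapOnBallZdS d N β (2ε) ε w m A`
gives `UniformMassGapOnLoopBall d N β w ε m A`. [folklore] -/
theorem UniformMassGapOnBallZdS.uniformMassGapOnLoopBall (h : UniformMassGapOnBallZdS d N β (2 * ε) ε w m A) :
    UniformMassGapOnLoopBall d N β w ε m A :=
  ⟨h.1, fun _ _ _ hfin hn => h.2 _ (memBallZdS_loopFamilyAction hfin hn)⟩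

end Balls

end Summit.Ventures.YMGap.RobustBall

end
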